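import Summits.QuantumFields.BalabanUV.Beta.GAN24.ExponentialChartCovariantTaylor

/-!
# `BalabanUV.Beta.GAN24.ExponentialChartMixedBackgrounds` — binder row G-an2-4 ∕ (CONV-C), route R7 «TWO CURRENCIES», PART 253: THE MIXED JETS OF THE TWO-PARAMETER EXPONENTIAL CHART ARE
# BACKGROUNDS, BY POLARISATION OF PART 246.  For two REAL Lipschitz backgrounds `A, B` (`(α, β)`, all levels) the mixed jets of `U_{s,r} = exp(iη(sA + rB))` at the origin (PART 252:
# connection `−(iA)(iB)∕n`, zeroth order `−2Σ_ν(iA_ν)(iB_ν) = 2Σ_νA_νB_ν`) are HALF THE POLARISATION of the second jets of the one-parameter charts of `A + B`, `A`, `B` (PART 245 ∕ 246: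
# `−(iX)²∕n`, `−Σ_ν((iX_ν)² + (−iX_ν)²)`), hence a Lipschitz background `(2(1+2α)², 2(1+2α)²(6β+2))` resp. a bounded background `(3d(1+2α)², 6d(1+2α)²(2β+1))` — by three closure rules
# (monotonicity in the constants, sums, constant multiples) proved here for NE2's `LipschitzBackground` ∕ `BoundedBackground`.  §3 records the jet polarisation identities and the
# additivity of the coupling letter `(V, W) ↦ P(V) + P(V)ᴴ + diag W` that PART 254 uses to identify the mixed partial with half the polarisation of PART 247's `N = 2`
# (unit b2b-balaban-gan24-p3, gen 66; v1)

NOT IN PRINT; OUR PROOF ([folklore] elementary estimates and bookkeeping BY NAME over NE2's `LipschitzBackground` ∕ `BoundedBackground`, PART 246 (`lipschitzBackground_expJetV`,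
`boundedBackground_expJetZ`), PART 245 (`iteratedDeriv_connV_expChart`), PART 241 (`Pmodel_apply`); nothing printed is a hypothesis).
HONEST FRAMING (cell contract, verbatim): «discharging `BetaPertH` makes Bałaban's UV stability UNCONDITIONAL — a real constructive-QFT result; it is NOT the
continuum limit and NOT the Clay problem.»  HONEST DEPENDENCY (verbatim): «continuum YM on T⁴ ⇐ BetaPertH ∧ nine spine estimates (0/9 proved); BetaPertH ⇐
(D1) ∧ (D4) ∧ CAP+tail; G-an2-4 gates asym, D1 and NE2/3/4.»

WHAT THIS FILE PROVES (0 sorry, 0 `def`; `A, B` REAL, `n_k = L^k`):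
* §1 (closure) `lipschitzBackground_mono ∕ _add ∕ _const_mul`, `boundedBackground_mono ∕ _add ∕ _const_mul`, `lipschitzBackground_ofReal_add` (the complexified sum `A + B` is Lipschitz
  `(α + α′, β + β′)`), `lipschitzBackground_negI_mul` (`−iA` is Lipschitz `(α, β)`).
* §2 (the mixed jets) `mixedJetV_eq_half_polarisation`, `mixedJetZ_eq_half_polarisation` (pointwise), **`lipschitzBackground_mixedJetV`** (`x ↦ −(iA(x))(iB(x))∕n_k` is Lipschitz
  `(2(1+2α)², 2(1+2α)²(6β+2))`), **`boundedBackground_mixedJetZ`** (`x ↦ −2Σ_ν(iA_ν(x))(iB_ν(x))` is bounded `(3d(1+2α)², 6d(1+2α)²(2β+1))`) for `A, B` Lipschitz `(α, β)`.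
* §3 (identities for PART 254) `jetV_one_expChart` (`∂_s(−w)|₀ = −iX`), `jetV_one_add`, `jetV_two_add`, `jetZ_two_add` (the first ∕ second jets of the chart of `A + B` are `a + b` ∕
  `a₂ + 2c + b₂` pointwise), `Pmodel_add'`, **`couplingLetter_add`**, **`couplingLetter_two_mul`** (additivity of `(V, W) ↦ P(V) + P(V)ᴴ + diag W`).
WHAT IT DOES NOT DO: the END and the polarisation theorem (PART 254).  SUPPLIER work; NEVER «G-an2-4 closed»; NOT (CONV-C), NOT D1, NOT `BetaPertH`, NOT continuum, NOT Clay.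
Records: `HOME/b2b-balaban-gan24-p3/gen66/README.md`.
-/

noncomputable section

open scoped BigOperators ComplexConjugate Matrix Matrix.Norms.L2Operator
open Filter Topology

namespace Summit.QuantumFields.BalabanUV.Beta.GAN24.ExponentialChartMixedBackgrounds

open Literature.MathematicalPhysics.QuantumFieldTheory.Balaban1983to89
open Literature.MathematicalPhysics.QuantumFieldTheory.Balaban1983to89.B5Prop11Plancherel (Tor fine)
open Literature.MathematicalPhysics.QuantumFieldTheory.Balaban1983to89.B5G183RateUnitTower (lev)
open Summit.QuantumFields.BalabanUV.T4Continuum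
open Summit.QuantumFields.BalabanUV.T4Continuum.BalabanAveragedTowerUnit (idx)
open Summit.QuantumFields.BalabanUV.T4Continuum.BlockPairingGeometry (tau parT)
open Summit.QuantumFields.BalabanUV.T4Continuum.FirstOrderBackgroundModel (LipschitzBackground Pmodel)
open Summit.QuantumFields.BalabanUV.T4Continuum.PerturbationAlgebra (BoundedBackground)
open Summit.QuantumFields.BalabanUV.T4Continuum.AbelianCovariantLaplacian (connV)
open Summit.QuantumFields.BalabanUV.Beta.GAN24.CouplingCurveTaylor (Pmodel_apply)
open Summit.QuantumFields.BalabanUV.Beta.GAN24.ExponentialChartJets (iteratedDeriv_connV_expChart)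
open Summit.QuantumFields.BalabanUV.Beta.GAN24.ExponentialChartBackgrounds (lipschitzBackground_expJetV boundedBackground_expJetZ)

variable {d : ℕ} (L : ℕ) [NeZero L] (M : Fin d → ℕ) [hM : ∀ μ, NeZero (M μ)]

/-! ## §1 Closure rules for Lipschitz ∕ bounded backgrounds -/

section Closure

omit [NeZero L] hM in
/-- monotonicity in the constants. [folklore] -/
theorem lipschitzBackground_mono {V : (k : ℕ) → Fin d → (idx L M k → ℂ)} {α β α' β' : ℝ} (h : LipschitzBackground L M V α β) (hα : α ≤ α') (hβ : β ≤ β') :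
    LipschitzBackground L M V α' β' where
  nonneg := ⟨h.nonneg.1.trans hα, h.nonneg.2.trans hβ⟩
  bound := fun k μ i => (h.bound k μ i).trans hα
  lipschitz := fun k μ ν i => (h.lipschitz k μ ν i).trans (div_le_div_of_nonneg_right hβ (Nat.cast_nonneg _))
  consistent := fun k μ i => (h.consistent k μ i).trans (div_le_div_of_nonneg_right hβ (Nat.cast_nonneg _))

omit [NeZero L] hM in
/-- sums: `(α + α′, β + β′)`. [folklore] -/
theorem lipschitzBackground_add {V V' : (k : ℕ) → Fin d → (idx L M k → ℂ)} {α β α' β' : ℝ} (h : LipschitzBackground L M V α β) (h' : LipschitzBackground L M V' α' β') :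
    LipschitzBackground L M (fun k ν x => V k ν x + V' k ν x) (α + α') (β + β') where
  nonneg := ⟨add_nonneg h.nonneg.1 h'.nonneg.1, add_nonneg h.nonneg.2 h'.nonneg.2⟩
  bound := fun k μ i => (norm_add_le _ _).trans (add_le_add (h.bound k μ i) (h'.bound k μ i))
  lipschitz := fun k μ ν i => by
    rw [add_div]
    calc _ = ‖(V k μ (tau (fine (lev L k) M) ν i) - V k μ i) + (V' k μ (tau (fine (lev L k) M) ν i) - V' k μ i)‖ := by congr 1; ring
      _ ≤ _ := (norm_add_le _ _).trans (add_le_add (h.lipschitz k μ ν i) (h'.lipschitz k μ ν i))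
  consistent := fun k μ i => by
    rw [add_div]
    calc _ = ‖(V (k + 1) μ i - V k μ (parT (lev L k) L M i)) + (V' (k + 1) μ i - V' k μ (parT (lev L k) L M i))‖ := by congr 1; ring
      _ ≤ _ := (norm_add_le _ _).trans (add_le_add (h.consistent k μ i) (h'.consistent k μ i))

omit [NeZero L] hM in
/-- constant multiples: `(‖c‖α, ‖c‖β)`. [folklore] -/
theorem lipschitzBackground_const_mul {V : (k : ℕ) → Fin d → (idx L M k → ℂ)} {α β : ℝ} (h : LipschitzBackground L M V α β) (c : ℂ) :
    LipschitzBackground L M (fun k ν x => c * V k ν x) (‖c‖ * α) (‖c‖ * β) where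
  nonneg := ⟨mul_nonneg (norm_nonneg c) h.nonneg.1, mul_nonneg (norm_nonneg c) h.nonneg.2⟩
  bound := fun k μ i => by
    rw [norm_mul]
    exact mul_le_mul_of_nonneg_left (h.bound k μ i) (norm_nonneg c)
  lipschitz := fun k μ ν i => by
    rw [← mul_sub, norm_mul, mul_div_assoc]
    exact mul_le_mul_of_nonneg_left (h.lipschitz k μ ν i) (norm_nonneg c)
  consistent := fun k μ i => by
    rw [← mul_sub, norm_mul, mul_div_assoc]
    exact mul_le_mul_of_nonneg_left (h.consistent k μ i) (norm_nonneg c)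

omit [NeZero L] hM in
/-- monotonicity in the constants. [folklore] -/
theorem boundedBackground_mono {W : (k : ℕ) → (idx L M k → ℂ)} {α β α' β' : ℝ} (h : BoundedBackground L M W α β) (hα : α ≤ α') (hβ : β ≤ β') :
    BoundedBackground L M W α' β' where
  nonneg := ⟨h.nonneg.1.trans hα, h.nonneg.2.trans hβ⟩
  bound := fun k i => (h.bound k i).trans hα
  consistent := fun k i => (h.consistent k i).trans (div_le_div_of_nonneg_right hβ (Nat.cast_nonneg _))

omit [NeZero L] hM in
/-- sums: `(α + α′, β + β′)`. [folklore] -/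
theorem boundedBackground_add {W W' : (k : ℕ) → (idx L M k → ℂ)} {α β α' β' : ℝ} (h : BoundedBackground L M W α β) (h' : BoundedBackground L M W' α' β') :
    BoundedBackground L M (fun k x => W k x + W' k x) (α + α') (β + β') where
  nonneg := ⟨add_nonneg h.nonneg.1 h'.nonneg.1, add_nonneg h.nonneg.2 h'.nonneg.2⟩
  bound := fun k i => (norm_add_le _ _).trans (add_le_add (h.bound k i) (h'.bound k i))
  consistent := fun k i => by
    rw [add_div]
    calc _ = ‖(W (k + 1) i - W k (parT (lev L k) L M i)) + (W' (k + 1) i - W' k (parT (lev L k) L M i))‖ := by congr 1; ring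
      _ ≤ _ := (norm_add_le _ _).trans (add_le_add (h.consistent k i) (h'.consistent k i))

omit [NeZero L] hM in
/-- constant multiples: `(‖c‖α, ‖c‖β)`. [folklore] -/
theorem boundedBackground_const_mul {W : (k : ℕ) → (idx L M k → ℂ)} {α β : ℝ} (h : BoundedBackground L M W α β) (c : ℂ) :
    BoundedBackground L M (fun k x => c * W k x) (‖c‖ * α) (‖c‖ * β) where
  nonneg := ⟨mul_nonneg (norm_nonneg c) h.nonneg.1, mul_nonneg (norm_nonneg c) h.nonneg.2⟩
  bound := fun k i => by
    rw [norm_mul]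
    exact mul_le_mul_of_nonneg_left (h.bound k i) (norm_nonneg c)
  consistent := fun k i => by
    rw [← mul_sub, norm_mul, mul_div_assoc]
    exact mul_le_mul_of_nonneg_left (h.consistent k i) (norm_nonneg c)

omit [NeZero L] hM in
/-- the complexified sum of two real backgrounds: `(α + α′, β + β′)`. [folklore] -/
theorem lipschitzBackground_ofReal_add {A B : (k : ℕ) → Fin d → (idx L M k → ℝ)} {α β α' β' : ℝ} (hA : LipschitzBackground L M (fun k ν x => (A k ν x : ℂ)) α β)
    (hB : LipschitzBackground L M (fun k ν x => (B k ν x : ℂ)) α' β') :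
    LipschitzBackground L M (fun k ν x => ((A k ν x + B k ν x : ℝ) : ℂ)) (α + α') (β + β') := by
  have e : (fun k ν (x : idx L M k) => ((A k ν x + B k ν x : ℝ) : ℂ)) = fun k ν x => (A k ν x : ℂ) + (B k ν x : ℂ) := by
    funext k ν x
    push_cast
    rfl
  rw [e]
  exact lipschitzBackground_add L M hA hB

omit [NeZero L] hM in
/-- `−iA` is Lipschitz `(α, β)` when the real background `A` is (`‖−I‖ = 1`). [folklore] -/
theorem lipschitzBackground_negI_mul {A : (k : ℕ) → Fin d → (idx L M k → ℝ)} {α β : ℝ} (hA : LipschitzBackground L M (fun k ν x => (A k ν x : ℂ)) α β) :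
    LipschitzBackground L M (fun k ν x => -(Complex.I * (A k ν x : ℂ))) α β := by
  have h := lipschitzBackground_const_mul L M hA (-Complex.I)
  rw [norm_neg, Complex.norm_I, one_mul, one_mul] at h
  have e : (fun k ν (x : idx L M k) => -Complex.I * (A k ν x : ℂ)) = fun k ν x => -(Complex.I * (A k ν x : ℂ)) := by
    funext k ν x
    rw [neg_mul]
  rw [e] at h
  exact h

end Closure

/-! ## §2 The mixed jets are backgrounds (polarisation of PART 246's second jets) -/

section Mixed

omit [NeZero L] hM in
/-- the mixed connection jet is half the polarisation of the second connection jets: `−(iA)(iB)∕n = ½[−(i(A+B))²∕n] − ½[−(iA)²∕n] − ½[−(iB)²∕n]` (PART 246's shape `i = 1`). [folklore] -/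
theorem mixedJetV_eq_half_polarisation (A B : (k : ℕ) → Fin d → (idx L M k → ℝ)) :
    (fun k ν (x : idx L M k) => -(Complex.I * (A k ν x : ℂ)) * (Complex.I * (B k ν x : ℂ) / ((lev L k : ℕ) : ℂ)))
      = fun k ν x => (1 / 2 : ℂ) * -((Complex.I * ((A k ν x + B k ν x : ℝ) : ℂ)) ^ (1 + 1) / ((lev L k : ℕ) : ℂ) ^ 1)
          + (-1 / 2 : ℂ) * -((Complex.I * (A k ν x : ℂ)) ^ (1 + 1) / ((lev L k : ℕ) : ℂ) ^ 1) + (-1 / 2 : ℂ) * -((Complex.I * (B k ν x : ℂ)) ^ (1 + 1) / ((lev L k : ℕ) : ℂ) ^ 1) := by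
  funext k ν x
  push_cast
  ring

omit [NeZero L] hM in
/-- the mixed zeroth-order jet is half the polarisation of the second zeroth-order jets: `−2Σ_ν(iA_ν)(iB_ν) = ½Z₂(A+B) − ½Z₂(A) − ½Z₂(B)`, `Z₂(X) = −Σ_ν((iX_ν)² + (−iX_ν)²)` (PART 246's shape
`i = 0`). [folklore] -/
theorem mixedJetZ_eq_half_polarisation (A B : (k : ℕ) → Fin d → (idx L M k → ℝ)) :
    (fun k (x : idx L M k) => -2 * ∑ ν, (Complex.I * (A k ν x : ℂ)) * (Complex.I * (B k ν x : ℂ)))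
      = fun k x => (1 / 2 : ℂ) * -((∑ ν, ((Complex.I * ((A k ν x + B k ν x : ℝ) : ℂ)) ^ (0 + 2) + (-(Complex.I * ((A k ν x + B k ν x : ℝ) : ℂ))) ^ (0 + 2))) / ((lev L k : ℕ) : ℂ) ^ 0)
          + (-1 / 2 : ℂ) * -((∑ ν, ((Complex.I * (A k ν x : ℂ)) ^ (0 + 2) + (-(Complex.I * (A k ν x : ℂ))) ^ (0 + 2))) / ((lev L k : ℕ) : ℂ) ^ 0)
          + (-1 / 2 : ℂ) * -((∑ ν, ((Complex.I * (B k ν x : ℂ)) ^ (0 + 2) + (-(Complex.I * (B k ν x : ℂ))) ^ (0 + 2))) / ((lev L k : ℕ) : ℂ) ^ 0) := by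
  funext k x
  simp only [pow_zero, div_one, Finset.mul_sum, mul_neg, ← Finset.sum_neg_distrib, ← Finset.sum_add_distrib]
  refine Finset.sum_congr rfl fun ν _ => ?_
  push_cast
  ring

omit hM in
/-- **`lipschitzBackground_mixedJetV` — THE MIXED CONNECTION JET IS A LIPSCHITZ BACKGROUND `(2(1+2α)², 2(1+2α)²(6β+2))`** when the real backgrounds `A, B` are Lipschitz `(α, β)`:
half the polarisation of PART 246's `lipschitzBackground_expJetV` (`N = 2`, `i = 1`) for `A + B` (Lipschitz `(2α, 2β)`), `A`, `B`, then the closure rules. [folklore] -/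
theorem lipschitzBackground_mixedJetV {A B : (k : ℕ) → Fin d → (idx L M k → ℝ)} {α β : ℝ} (hA : LipschitzBackground L M (fun k ν x => (A k ν x : ℂ)) α β)
    (hB : LipschitzBackground L M (fun k ν x => (B k ν x : ℂ)) α β) :
    LipschitzBackground L M (fun k ν (x : idx L M k) => -(Complex.I * (A k ν x : ℂ)) * (Complex.I * (B k ν x : ℂ) / ((lev L k : ℕ) : ℂ)))
      (2 * (1 + 2 * α) ^ 2) (2 * ((1 + 2 * α) ^ 2 * (6 * β + 2))) := by
  obtain ⟨hα, hβ⟩ := hA.nonneg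
  have hAB := lipschitzBackground_ofReal_add L M hA hB
  have jAB := lipschitzBackground_expJetV L M (A := fun k ν x => A k ν x + B k ν x) hAB (N := 2) (i := 1) le_rfl
  have jA := lipschitzBackground_expJetV L M hA (N := 2) (i := 1) le_rfl
  have jB := lipschitzBackground_expJetV L M hB (N := 2) (i := 1) le_rfl
  have h := lipschitzBackground_add L M (lipschitzBackground_add L M (lipschitzBackground_const_mul L M jAB (1 / 2 : ℂ)) (lipschitzBackground_const_mul L M jA (-1 / 2 : ℂ)))
    (lipschitzBackground_const_mul L M jB (-1 / 2 : ℂ))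
  have hn1 : ‖(1 / 2 : ℂ)‖ = 1 / 2 := by rw [norm_div, norm_one, Complex.norm_two]
  have hn2 : ‖(-1 / 2 : ℂ)‖ = 1 / 2 := by rw [norm_div, norm_neg, norm_one, Complex.norm_two]
  rw [hn1, hn2, ← mixedJetV_eq_half_polarisation L M A B] at h
  have hX : (1 + α) ^ 2 ≤ (1 + 2 * α) ^ 2 := pow_le_pow_left₀ (by linarith) (by linarith) 2
  have hY : (0 : ℝ) ≤ (1 + 2 * α) ^ 2 := by positivity
  have hXY : (1 + α) ^ 2 * (3 * β + 2) ≤ (1 + 2 * α) ^ 2 * (6 * β + 2) := mul_le_mul hX (by linarith) (by positivity) hY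
  refine lipschitzBackground_mono L M h ?_ ?_
  · nlinarith [hX, hY]
  · push_cast
    nlinarith [hXY, hY, mul_nonneg hY hβ]

omit hM in
/-- **`boundedBackground_mixedJetZ` — THE MIXED ZEROTH-ORDER JET IS A BOUNDED BACKGROUND `(3d(1+2α)², 6d(1+2α)²(2β+1))`** when the real backgrounds `A, B` are Lipschitz `(α, β)`:
half the polarisation of PART 246's `boundedBackground_expJetZ` (`N = 2`, `i = 0`) for `A + B`, `A`, `B`, then the closure rules. [folklore] -/
theorem boundedBackground_mixedJetZ {A B : (k : ℕ) → Fin d → (idx L M k → ℝ)} {α β : ℝ} (hA : LipschitzBackground L M (fun k ν x => (A k ν x : ℂ)) α β)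
    (hB : LipschitzBackground L M (fun k ν x => (B k ν x : ℂ)) α β) :
    BoundedBackground L M (fun k (x : idx L M k) => -2 * ∑ ν, (Complex.I * (A k ν x : ℂ)) * (Complex.I * (B k ν x : ℂ)))
      (3 * (d * (1 + 2 * α) ^ 2)) (6 * (d * ((1 + 2 * α) ^ 2 * (2 * β + 1)))) := by
  obtain ⟨hα, hβ⟩ := hA.nonneg
  have hAB := lipschitzBackground_ofReal_add L M hA hB
  have zAB := boundedBackground_expJetZ L M (A := fun k ν x => A k ν x + B k ν x) hAB (N := 2) (i := 0) le_rfl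
  have zA := boundedBackground_expJetZ L M hA (N := 2) (i := 0) le_rfl
  have zB := boundedBackground_expJetZ L M hB (N := 2) (i := 0) le_rfl
  have h := boundedBackground_add L M (boundedBackground_add L M (boundedBackground_const_mul L M zAB (1 / 2 : ℂ)) (boundedBackground_const_mul L M zA (-1 / 2 : ℂ)))
    (boundedBackground_const_mul L M zB (-1 / 2 : ℂ))
  have hn1 : ‖(1 / 2 : ℂ)‖ = 1 / 2 := by rw [norm_div, norm_one, Complex.norm_two]
  have hn2 : ‖(-1 / 2 : ℂ)‖ = 1 / 2 := by rw [norm_div, norm_neg, norm_one, Complex.norm_two]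
  rw [hn1, hn2, ← mixedJetZ_eq_half_polarisation L M A B] at h
  have hd : (0 : ℝ) ≤ d := Nat.cast_nonneg d
  have hX : (1 + α) ^ 2 ≤ (1 + 2 * α) ^ 2 := pow_le_pow_left₀ (by linarith) (by linarith) 2
  have hY : (0 : ℝ) ≤ (1 + 2 * α) ^ 2 := by positivity
  have h1 : d * (1 + α) ^ 2 ≤ d * (1 + 2 * α) ^ 2 := mul_le_mul_of_nonneg_left hX hd
  have h2 : d * ((1 + α) ^ 2 * (β + 1)) ≤ d * ((1 + 2 * α) ^ 2 * (2 * β + 1)) :=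
    mul_le_mul_of_nonneg_left (mul_le_mul hX (by linarith) (by positivity) hY) hd
  refine boundedBackground_mono L M h ?_ ?_
  · nlinarith [h1]
  · nlinarith [h2]

end Mixed

/-! ## §3 Identities for PART 254: the first jets, the jets of `A + B`, additivity of the coupling letter -/

section Identities

omit hM in
/-- the first connection jet of the exponential chart of `X` is `−iX` (PART 245, `n·θ = iX`). [folklore] -/
theorem jetV_one_expChart (X : (k : ℕ) → Fin d → (idx L M k → ℝ)) :
    (fun k ν (x : idx L M k) => iteratedDeriv 1 (fun s : ℝ => connV L M (fun k' ν' x' => Complex.exp ((Complex.I * (X k' ν' x' : ℂ) / ((lev L k' : ℕ) : ℂ)) * (s : ℂ))) k ν x) 0)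
      = fun k ν x => -(Complex.I * (X k ν x : ℂ)) := by
  funext k ν x
  have hn : ((lev L k : ℕ) : ℂ) ≠ 0 := by exact_mod_cast NeZero.ne (lev L k)
  rw [iteratedDeriv_connV_expChart, if_neg one_ne_zero, pow_one]
  field_simp

omit [NeZero L] hM in
/-- first jets add: `−i(A + B) = −iA + (−iB)`. [folklore] -/
theorem jetV_one_add (A B : (k : ℕ) → Fin d → (idx L M k → ℝ)) :
    (fun k ν (x : idx L M k) => -(Complex.I * ((A k ν x + B k ν x : ℝ) : ℂ)))
      = fun k ν x => -(Complex.I * (A k ν x : ℂ)) + -(Complex.I * (B k ν x : ℂ)) := by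
  funext k ν x
  push_cast
  ring

omit [NeZero L] hM in
/-- second connection jets polarise: `−(i(A+B))²∕n = −(iA)²∕n + 2·[−(iA)(iB)∕n] + (−(iB)²∕n)` (PART 246's shape `i = 1`). [folklore] -/
theorem jetV_two_add (A B : (k : ℕ) → Fin d → (idx L M k → ℝ)) :
    (fun k ν (x : idx L M k) => -((Complex.I * ((A k ν x + B k ν x : ℝ) : ℂ)) ^ (1 + 1) / ((lev L k : ℕ) : ℂ) ^ 1))
      = fun k ν x => -((Complex.I * (A k ν x : ℂ)) ^ (1 + 1) / ((lev L k : ℕ) : ℂ) ^ 1)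
          + 2 * (-(Complex.I * (A k ν x : ℂ)) * (Complex.I * (B k ν x : ℂ) / ((lev L k : ℕ) : ℂ))) + -((Complex.I * (B k ν x : ℂ)) ^ (1 + 1) / ((lev L k : ℕ) : ℂ) ^ 1) := by
  funext k ν x
  push_cast
  ring

omit [NeZero L] hM in
/-- second zeroth-order jets polarise: `Z₂(A + B) = Z₂(A) + 2·[−2Σ_ν(iA_ν)(iB_ν)] + Z₂(B)` (PART 246's shape `i = 0`). [folklore] -/
theorem jetZ_two_add (A B : (k : ℕ) → Fin d → (idx L M k → ℝ)) :
    (fun k (x : idx L M k) => -((∑ ν, ((Complex.I * ((A k ν x + B k ν x : ℝ) : ℂ)) ^ (0 + 2) + (-(Complex.I * ((A k ν x + B k ν x : ℝ) : ℂ))) ^ (0 + 2))) / ((lev L k : ℕ) : ℂ) ^ 0))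
      = fun k x => -((∑ ν, ((Complex.I * (A k ν x : ℂ)) ^ (0 + 2) + (-(Complex.I * (A k ν x : ℂ))) ^ (0 + 2))) / ((lev L k : ℕ) : ℂ) ^ 0)
          + 2 * (-2 * ∑ ν, (Complex.I * (A k ν x : ℂ)) * (Complex.I * (B k ν x : ℂ)))
          + -((∑ ν, ((Complex.I * (B k ν x : ℂ)) ^ (0 + 2) + (-(Complex.I * (B k ν x : ℂ))) ^ (0 + 2))) / ((lev L k : ℕ) : ℂ) ^ 0) := by
  funext k x
  simp only [pow_zero, div_one, Finset.mul_sum, ← Finset.sum_neg_distrib, ← Finset.sum_add_distrib]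
  refine Finset.sum_congr rfl fun ν _ => ?_
  push_cast
  ring

/-- the first-order coupling is additive in the background. [folklore] -/
theorem Pmodel_add' (V V' : (k : ℕ) → Fin d → (idx L M k → ℂ)) (k : ℕ) :
    Pmodel L M (fun k ν x => V k ν x + V' k ν x) k = Pmodel L M V k + Pmodel L M V' k := by
  ext a b
  simp only [Matrix.add_apply, Pmodel_apply, add_mul, Finset.sum_add_distrib]

/-- **`couplingLetter_add`** — the coupling letter `(V, W) ↦ P(V) + P(V)ᴴ + diag W` is additive. [folklore] -/
theorem couplingLetter_add (V V' : (k : ℕ) → Fin d → (idx L M k → ℂ)) (W W' : (k : ℕ) → (idx L M k → ℂ)) (k : ℕ) :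
    Pmodel L M (fun k ν x => V k ν x + V' k ν x) k + (Pmodel L M (fun k ν x => V k ν x + V' k ν x) k)ᴴ + Matrix.diagonal (fun x => W k x + W' k x)
      = (Pmodel L M V k + (Pmodel L M V k)ᴴ + Matrix.diagonal (W k)) + (Pmodel L M V' k + (Pmodel L M V' k)ᴴ + Matrix.diagonal (W' k)) := by
  have hd : Matrix.diagonal (fun x => W k x + W' k x) = Matrix.diagonal (W k) + Matrix.diagonal (W' k) := by
    rw [← Matrix.diagonal_add]
  rw [Pmodel_add', Matrix.conjTranspose_add, hd]
  abel

/-- **`couplingLetter_two_mul`** — doubling the backgrounds doubles the letter: `P(2V) + P(2V)ᴴ + diag(2W) = 2·(P(V) + P(V)ᴴ + diag W)`. [folklore] -/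
theorem couplingLetter_two_mul (V : (k : ℕ) → Fin d → (idx L M k → ℂ)) (W : (k : ℕ) → (idx L M k → ℂ)) (k : ℕ) :
    Pmodel L M (fun k ν x => 2 * V k ν x) k + (Pmodel L M (fun k ν x => 2 * V k ν x) k)ᴴ + Matrix.diagonal (fun x => 2 * W k x)
      = (2 : ℂ) • (Pmodel L M V k + (Pmodel L M V k)ᴴ + Matrix.diagonal (W k)) := by
  have eV : (fun k ν (x : idx L M k) => 2 * V k ν x) = fun k ν x => V k ν x + V k ν x := by
    funext k ν x
    rw [two_mul]
  have eW : (fun (x : idx L M k) => 2 * W k x) = fun x => W k x + W k x := by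
    funext x
    rw [two_mul]
  rw [eV, eW, couplingLetter_add, two_smul]

end Identities

end Summit.QuantumFields.BalabanUV.Beta.GAN24.ExponentialChartMixedBackgrounds

end
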